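/-
COR-CM (cell pub-hodgecm2, stage 2 of the Hodge ladder) — Δ2 BRIDGE, item (c) J-RECORD PIN: the LEVEL LAW of the inhabited
J2 interface, KEPT THROUGH THE EXISTENTIAL.  Seat prover-pub-hodgecm2-d2bridge-prove-2-g3-0 (interface `ComponentAlbanese` =
prove-2 lineage ✔ p370295; inhabitant = d2bridge-prove-5 ✔∕placed `ComponentAlbanesePin`).  Closes the J-side SEAM reported by
d2bridge-wb-4 (HOME/INBOX 2026-08-23 l.11820): prove-3's (d) compositions `nonempty_hcmPieces_atJRecordPin ∕ _atUniformRest` take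
`(J : ComponentAlbanese …) (hΓ : ∀ K₁, ((J.Γof K₁).K : Subgroup ↥V.adelicFin) = (K₁.1 : Subgroup C.G))`, while
`nonempty_componentAlbanesePin[Total]` export only `Nonempty (ComponentAlbanese …)` — after `Classical.choice` the law `Γof = levelOf V`
of the witness is lost.  Here: the SAME witness with its law, as `∃ J, <law>`, at Liu's explicit §4.2 carrier and at the TOTAL carrier.
Theorems only (no definition, no `sorry`, no new axiom); the cited named facts and the standing carriers are explicit binders.
FRAMING: HC_CM is NOT proved; «Δ2 BRIDGE CLOSED» is NOT claimed; nothing here is a display or a pointer move.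
-/
import Summits.HodgeConjecture.CorCM.D2Bridge.ComponentAlbanesePin
import HarnessLib

/-!
# Δ2 bridge, J-record pin: `ComponentAlbanese` inhabited WITH ITS LEVEL LAW

[Liu2021] Y. Liu, *Fourier–Jacobi cycles and arithmetic relative trace formula*, Camb. J. Math. **9** (2021) 1–147 = arXiv:2102.11518;
`l. NNNN` = lines of the author's TeX `FJcycle.tex`.

For the model's tower over `(L, ι₁, V)` (`4 ≤ [L:ℚ]`) and Liu's §4.2 datum (levels `K ⊆ K_f(3)`, `X_K`, `A_K = Alb_{X_K}`; §4.2
l. 2053–2074, App. C Prop. C.5 l. 4627–4628 «sufficiently small open compact subgroups `K`»):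

* `ComponentAlbanese.levelLaw_transport` — the level law `(J.Γof K₁).K = K₁` is carried by `ComponentAlbanese.transport` along an
  equality of §4.2 data (`subst`).
* `exists_componentAlbanesePin_levelLaw` — at the explicit carrier `Model.sec42DataOfFourLe …` with its Hecke translates: **there is a
  `J : ComponentAlbanese …` whose level dictionary IS `K ↦ (U(L⁺) ∩ K, K)`**, i.e. `∀ K₁, (J.Γof K₁).K = K₁` — prove-5's witness
  (`Γof := levelOf V`, `alb K h := albOnPiece (C.alb K) (componentInj K h) (basePt K h)`, laws (ii)–(iv), (v′) of `ComponentAlbanesePin`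
  §1–§2) re-assembled with the law exposed (`levelOf_K`, `rfl`).
* `exists_componentAlbanesePinTotal_levelLaw` — the same at the TOTAL carrier `Model.sec42DataOf …` ∕ `Model.sec42DataOf_heckeTranslates …`
  of the END displays (transport along `Model.sec42DataOf_eq_of_four_le`).

Consumers (the (c)(d) BY-VALUE assemblies at instance `ῑ₁`, re-key (c-S.1) and adapter (c-S.2) alike):
`J := Classical.choose (exists_componentAlbanesePinTotal_levelLaw …)`, `hΓ := Classical.choose_spec (exists_componentAlbanesePinTotal_levelLaw …)`
— exactly the `(J) (hΓ)` binders of prove-3's `nonempty_hcmPieces_atJRecordPin ∕ _atUniformRest ∕ _atLiuDictionaryPin`.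

HC_CM is NOT proved; nothing here is a display or a pointer move.
-/

set_option autoImplicit false

noncomputable section

open Function CategoryTheory CategoryTheory.Limits AlgebraicGeometry NumberField
open Literature.AlgebraicGeometry.Motives
open Literature.AlgebraicGeometry.HodgeTheory
open Literature.AlgebraicGeometry.ShimuraVarieties
open Literature.AlgebraicGeometry.ShimuraVarieties.UnitaryCanonicalModel
open Literature.NumberTheory.Automorphic Literature.NumberTheory.Automorphic.PicardCM
open Literature.NumberTheory.Automorphic.Liu2021 Literature.NumberTheory.Automorphic.Liu2021.AppendixC
open Literature.NumberTheory.Transcendental (Arapura2012_Cor_15_4_6)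
open Summit.HodgeConjecture.CorCM.Model Summit.HodgeConjecture.CorCM.HComp
open HodgeCM.Model HodgeCM.Model.LevelTranslate HodgeCM.Model.TowerLevel

namespace Summit.HodgeConjecture.CorCM.D2Bridge

variable {L : HodgeCM.CMField} {ι₁ : L →+* ℂ}

/-! ## §1 The level law is transported along an equality of §4.2 data -/

/-- **The level law survives `ComponentAlbanese.transport`**: if `(J.Γof K₁).K = K₁` for every sufficiently small `K₁` of the datum `C`,
then the same holds for `J.transport e` over `C'` (`e : C = C'`; `subst`).  Used for the glue `sec42DataOfFourLe … = sec42DataOf …`.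
[cite: Liu2021, Prop. C.5 (FJcycle.tex l. 4627–4628); §4.2 l. 2053–2074] -/
theorem ComponentAlbanese.levelLaw_transport {hHD : exists_isReal_hodgeModel} {hI : hodgePQ_independent_of_hodgeModel}
    {hU : BallQuotientUniformisedDatum} {h₃ : CMAbelianVarietyRealised} {hA : Arapura2012_Cor_15_4_6}
    {V : HodgeCM.HermSpace3 L ι₁} {h : exists_recordSystem} {Φ : CMType (pkgF L)} {isotropicAt : ℕ → Prop}
    {C C' : Sec42Data (Model.honestP5Of h (pkgF L) ι₁ (pkgV V) Φ) isotropicAt} {T : C.HeckeTranslates} [Algebra L ℂ]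
    (J : ComponentAlbanese hHD hI hU h₃ hA V h Φ C T) (e : C = C')
    (hΓ : ∀ K₁ : C5.SmallLevel C.S.K₀, ((J.Γof K₁).K : Subgroup ↥V.adelicFin) = (K₁.1 : Subgroup C.G)) :
    ∀ K₁ : C5.SmallLevel C'.S.K₀, (((J.transport e).Γof K₁).K : Subgroup ↥V.adelicFin) = (K₁.1 : Subgroup C'.G) := by
  subst e
  exact hΓ

/-! ## §2 The interface inhabited together with its level law -/

/-- **The J2 interface INHABITED WITH ITS LEVEL LAW** at Liu's explicit §4.2 carrier over the honest datum and its Hecke translates: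
there is `J : ComponentAlbanese …` with `(J.Γof K₁).K = K₁` for every sufficiently small `K₁` — the witness of
`nonempty_componentAlbanesePin` (`Γof K := levelOf V K = (U(L⁺) ∩ K, K)`, `alb K h := albOnPiece (C.alb K) (componentInj K h) (basePt K h)`,
laws (ii)–(iv), (v′)), with the law read off `levelOf_K` (`rfl`).
[cite: Liu2021, proof of Lemma 2.4 (1) (FJcycle.tex l. 1220–1228); §4.2 l. 2062–2074; Prop. C.5 l. 4627–4628] [cite: Deligne1979ShimuraVarieties, §2.1.2] -/
theorem exists_componentAlbanesePin_levelLaw (hHD : exists_isReal_hodgeModel) (hI : hodgePQ_independent_of_hodgeModel)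
    (hU : BallQuotientUniformisedDatum) (h₃ : CMAbelianVarietyRealised) (hA : Arapura2012_Cor_15_4_6)
    (hU7 : heckeTranslate_definedOver) (V : HodgeCM.HermSpace3 L ι₁) (h : exists_recordSystem) (h4 : 4 ≤ Module.finrank ℚ L)
    [Algebra L ℂ] (hι : (algebraMap L ℂ).comp (cmConjRingHom L) = ι₁) (Φ : CMType (pkgF L)) (iso : ℕ → Prop) :
    ∃ J : ComponentAlbanese hHD hI hU h₃ hA V h Φ (sec42DataOfFourLe h (pkgV V) Φ h4 iso)
        (sec42DataOfFourLe_heckeTranslates hU7 h (pkgV V) Φ h4 iso),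
      ∀ K₁ : C5.SmallLevel (sec42DataOfFourLe h (pkgV V) Φ h4 iso).S.K₀,
        ((J.Γof K₁).K : Subgroup ↥V.adelicFin) = (K₁.1 : Subgroup (sec42DataOfFourLe h (pkgV V) Φ h4 iso).G) :=
  ⟨{ Γof := levelOf V
     belowConjThree := belowConjThree_levelOf V
     Γof_mono := fun hle => levelOf_mono V hle
     Γof_hecke := fun _ _ _ hle => levelOf_le_conj_of_heckeLE V hle
     alb := fun K hh =>
       haveI := geometricallyIrreducible_pms hU h₃ (code V K hh)
       albOnPiece ((sec42DataOfFourLe h (pkgV V) Φ h4 iso).alb K) (componentInj V hU h₃ h4 h hHD hι K hh) (basePt V hU h₃ K hh)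
     pull_alb_rel := fun K _ _ _ r => by
       rw [HodgeCM.Model.universeOf_pull]
       exact pull_albOnPiece_componentInj_rel V hU h₃ h4 h hHD hι hA Φ iso K r 1
     pull_alb_Atr := fun f hh => by
       rw [HodgeCM.Model.universeOf_pull]
       exact pull_albOnPiece_componentInj_Atr V hU h₃ h4 h hHD hι hA Φ iso f hh 1
     pull_alb_albTr := fun g _ _ hK hh => by
       rw [HodgeCM.Model.universeOf_pull]
       exact pull_albOnPiece_componentInj_albTr V hU h₃ h4 h hHD hι hA hU7 Φ iso g hK hh 1
     alb_detect := fun K _ φ hφ =>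
       exists_pull_albOnPiece_componentInj_ne_zero V hU h₃ h4 h hHD hι Φ iso K φ hφ }, fun _ => rfl⟩

/-- **The J2 interface WITH ITS LEVEL LAW at the TOTAL carrier `C := Model.sec42DataOf h iso` of the END displays**,
`T := Model.sec42DataOf_heckeTranslates` (DEFINED as the cast of the explicit translates along `Model.sec42DataOf_eq_of_four_le`):
`ComponentAlbanese.transport` of the previous witness, the law carried by `ComponentAlbanese.levelLaw_transport`.
The `(J) (hΓ)` binders of prove-3's (d) compositions are `Classical.choose ∕ Classical.choose_spec` of this statement.
[cite: Liu2021, §4.2 (FJcycle.tex l. 2053–2074); Prop. C.5 l. 4627–4628] -/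
theorem exists_componentAlbanesePinTotal_levelLaw (hHD : exists_isReal_hodgeModel) (hI : hodgePQ_independent_of_hodgeModel)
    (hU : BallQuotientUniformisedDatum) (h₃ : CMAbelianVarietyRealised) (hA : Arapura2012_Cor_15_4_6)
    (hU7 : heckeTranslate_definedOver) (V : HodgeCM.HermSpace3 L ι₁) (h : exists_recordSystem) (h4 : 4 ≤ Module.finrank ℚ L)
    [Algebra L ℂ] (hι : (algebraMap L ℂ).comp (cmConjRingHom L) = ι₁) (Φ : CMType (pkgF L))
    (iso : ∀ (F : Summit.HodgeConjecture.CorCM.CMField) (ι : F →+* ℂ) (_ : Summit.HodgeConjecture.CorCM.HermSpace3 F ι)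
      (_ : CMType F), ℕ → Prop) :
    ∃ J : ComponentAlbanese hHD hI hU h₃ hA V h Φ (sec42DataOf h iso (pkgF L) ι₁ (pkgV V) Φ)
        (sec42DataOf_heckeTranslates hU7 h (pkgV V) Φ iso h4),
      ∀ K₁ : C5.SmallLevel (sec42DataOf h iso (pkgF L) ι₁ (pkgV V) Φ).S.K₀,
        ((J.Γof K₁).K : Subgroup ↥V.adelicFin) = (K₁.1 : Subgroup (sec42DataOf h iso (pkgF L) ι₁ (pkgV V) Φ).G) := by
  obtain ⟨J, hJ⟩ := exists_componentAlbanesePin_levelLaw hHD hI hU h₃ hA hU7 V h h4 hι Φ (iso (pkgF L) ι₁ (pkgV V) Φ)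
  exact ⟨J.transport (sec42DataOf_eq_of_four_le h (pkgV V) Φ iso h4).symm,
    J.levelLaw_transport (sec42DataOf_eq_of_four_le h (pkgV V) Φ iso h4).symm hJ⟩

end Summit.HodgeConjecture.CorCM.D2Bridge

end
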